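import Summits.CriticalPhenomena.CardyFormulaZ2.Theorems.CardyUniqueLimitCardyRigidityDefs

/-!
# The `L³` domination of a regular driver: good events and their integrals (line `crossing-martingale`, crux `CardyRigidity`)

Measure-theoretic layer of the far-field MOMENT engine (stubs `stub_betaPinning` /
`stub_kernelAffineBeta`, crux `CardyRigidity`, stmt-CriticalPhenomena-0746).  From
`IsRegularDriver μ W 𝓕` at a time `t` we extract a strongly measurable nonnegative `B ∈ L³(μ)`
dominating the running supremum of `|W|` on `[0, t]` almost surely
(`exists_stronglyMeasurable_dominator`), and for an increasing sequence of thresholds `K n → ∞`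
we record the facts about the GOOD EVENTS `G n = {B ≤ K n}` that the moment expansion integrates:
measurability and monotonicity, `⋃ G n = univ`, the Markov bound `μ(G nᶜ) ≤ E[B³]/K n³`
(`measureReal_compl_good_le`), convergence of `∫_{G n} f → ∫ f` for integrable `f`
(`tendsto_setIntegral_good`) and of `μ(G n) → 1`, and integrability of `B, B², B³, W_t, W_t²`.
Mathlib only (plus the vocabulary file).
-/

noncomputable section

open MeasureTheory Filter Set Topology
open scoped NNReal ENNReal

namespace Summit.CriticalPhenomena.CardyFormulaZ2.Cruxes.CardyRigidity.CrossingMartingale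

namespace FarField

variable {Ω : Type*} {mΩ : MeasurableSpace Ω} {μ : Measure Ω} {W : Ω → ℝ≥0 → ℝ}
  {𝓕 : Filtration ℝ≥0 mΩ}

/-- **A strongly measurable `L³` dominator of the running supremum.**  For a regular driver and a
time `t` there is a strongly measurable `B ≥ 0` in `L³(μ)` with `|W_u| ≤ B` for all `u ≤ t`, almost
surely (a strongly measurable nonnegative version of the dominator in `IsRegularDriver`).
[folklore] -/
theorem exists_stronglyMeasurable_dominator (hreg : IsRegularDriver μ W 𝓕) (t : ℝ≥0) :
    ∃ B : Ω → ℝ, StronglyMeasurable B ∧ MemLp B 3 μ ∧ (∀ ω, 0 ≤ B ω) ∧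
      ∀ᵐ ω ∂μ, ∀ u, u ≤ t → |W ω u| ≤ B ω := by
  obtain ⟨B, hB3, hB0, hsup⟩ := hreg.2.2.2 t
  set g : Ω → ℝ := hB3.aestronglyMeasurable.mk B with hg
  have hgm : StronglyMeasurable g := hB3.aestronglyMeasurable.stronglyMeasurable_mk
  have hae : B =ᵐ[μ] g := hB3.aestronglyMeasurable.ae_eq_mk
  refine ⟨fun ω ↦ max (g ω) 0, hgm.sup stronglyMeasurable_const, ?_, fun ω ↦ le_max_right _ _, ?_⟩
  · have : (fun ω ↦ max (g ω) 0) =ᵐ[μ] B := by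
      filter_upwards [hae] with ω hω
      rw [← hω, max_eq_left (hB0 ω)]
    exact hB3.ae_eq this.symm
  · filter_upwards [hsup, hae] with ω hω hωg
    intro u hu
    exact (hω u hu).trans (by rw [hωg]; exact le_max_left _ _)

section Cube

variable {B : Ω → ℝ}

/-- `B ∈ L³`, `B ≥ 0`: `B³` is integrable. [folklore] -/
theorem integrable_cube_of_memLp_three (hB3 : MemLp B 3 μ) (hB0 : ∀ ω, 0 ≤ B ω) :
    Integrable (fun ω ↦ B ω ^ 3) μ := by
  have := hB3.integrable_norm_rpow (by norm_num) (by norm_num)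
  refine this.congr (Eventually.of_forall fun ω ↦ ?_)
  simp only [ENNReal.toReal_ofNat, Real.norm_eq_abs, abs_of_nonneg (hB0 ω)]
  norm_cast

/-- The good event `{B ≤ K}` is measurable. [folklore] -/
theorem measurableSet_good (hBm : StronglyMeasurable B) (K : ℝ) :
    MeasurableSet {ω | B ω ≤ K} :=
  measurableSet_le hBm.measurable measurable_const

end Cube

section Dominator

variable [IsProbabilityMeasure μ] {B : Ω → ℝ}

/-- `B ∈ L³` on a probability space is integrable. [folklore] -/
theorem integrable_of_memLp_three (hB3 : MemLp B 3 μ) : Integrable B μ :=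
  hB3.integrable (by norm_num)

/-- `B ∈ L³`, `B ≥ 0`: `B²` is integrable (probability space). [folklore] -/
theorem integrable_sq_of_memLp_three (hB3 : MemLp B 3 μ) (hB0 : ∀ ω, 0 ≤ B ω) :
    Integrable (fun ω ↦ B ω ^ 2) μ := by
  have h2 : MemLp B 2 μ := hB3.mono_exponent (by norm_num)
  have := h2.integrable_norm_rpow (by norm_num) (by norm_num)
  refine this.congr (Eventually.of_forall fun ω ↦ ?_)
  simp only [ENNReal.toReal_ofNat, Real.norm_eq_abs, abs_of_nonneg (hB0 ω)]
  norm_cast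

/-- **Markov at the third moment**: `μ{K < B} ≤ E[B³]/K³` for `K > 0`. [folklore] -/
theorem measureReal_lt_dominator_le (hB3 : MemLp B 3 μ) (hB0 : ∀ ω, 0 ≤ B ω) {K : ℝ}
    (hK : 0 < K) : μ.real {ω | K < B ω} ≤ (∫ ω, B ω ^ 3 ∂μ) / K ^ 3 := by
  have hint := integrable_cube_of_memLp_three hB3 hB0
  have hmk := mul_meas_ge_le_integral_of_nonneg (μ := μ) (f := fun ω ↦ B ω ^ 3)
    (Eventually.of_forall fun ω ↦ pow_nonneg (hB0 ω) 3) hint (K ^ 3)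
  have hsub : {ω | K < B ω} ⊆ {ω | K ^ 3 ≤ B ω ^ 3} := by
    intro ω hω
    simp only [mem_setOf_eq] at hω ⊢
    exact pow_le_pow_left₀ hK.le hω.le 3
  have hK3 : 0 < K ^ 3 := pow_pos hK 3
  rw [le_div_iff₀ hK3, mul_comm]
  exact (mul_le_mul_of_nonneg_left (measureReal_mono hsub) hK3.le).trans hmk

/-- **Complement of a good event is small**: `μ{B ≤ K}ᶜ ≤ E[B³]/K³`. [folklore] -/
theorem measureReal_compl_good_le (hB3 : MemLp B 3 μ) (hB0 : ∀ ω, 0 ≤ B ω) {K : ℝ}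
    (hK : 0 < K) : μ.real {ω | B ω ≤ K}ᶜ ≤ (∫ ω, B ω ^ 3 ∂μ) / K ^ 3 := by
  have : {ω | B ω ≤ K}ᶜ = {ω | K < B ω} := by ext ω; simp
  rw [this]
  exact measureReal_lt_dominator_le hB3 hB0 hK

omit [IsProbabilityMeasure μ] in
/-- The driver at time `t` is measurable (strongly adapted). [folklore] -/
theorem measurable_driver_at (hreg : IsRegularDriver μ W 𝓕) (t : ℝ≥0) :
    Measurable fun ω ↦ W ω t :=
  ((hreg.1 t).measurable).mono (𝓕.le t) le_rfl

/-- `W_t` is integrable (dominated by `B ∈ L³`). [folklore] -/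
theorem integrable_driver_at (hreg : IsRegularDriver μ W 𝓕) {t : ℝ≥0} (hB3 : MemLp B 3 μ)
    (hsup : ∀ᵐ ω ∂μ, ∀ u, u ≤ t → |W ω u| ≤ B ω) : Integrable (fun ω ↦ W ω t) μ := by
  refine Integrable.mono' (integrable_of_memLp_three hB3)
    (measurable_driver_at hreg t).aestronglyMeasurable ?_
  filter_upwards [hsup] with ω hω
  rw [Real.norm_eq_abs]
  exact hω t le_rfl

/-- `W_t²` is integrable (dominated by `B² ∈ L^{3/2}`). [folklore] -/
theorem integrable_driver_sq_at (hreg : IsRegularDriver μ W 𝓕) {t : ℝ≥0}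
    (hB3 : MemLp B 3 μ) (hB0 : ∀ ω, 0 ≤ B ω)
    (hsup : ∀ᵐ ω ∂μ, ∀ u, u ≤ t → |W ω u| ≤ B ω) : Integrable (fun ω ↦ (W ω t) ^ 2) μ := by
  refine Integrable.mono' (integrable_sq_of_memLp_three hB3 hB0)
    ((measurable_driver_at hreg t).pow_const 2).aestronglyMeasurable ?_
  filter_upwards [hsup] with ω hω
  rw [Real.norm_eq_abs, abs_pow, sq_abs]
  have h := hω t le_rfl
  have hB := hB0 ω
  rw [abs_le] at h
  nlinarith

/-! ### Good events -/

omit [IsProbabilityMeasure μ] in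
/-- For thresholds `K n` increasing to `∞`, the good events increase to the whole space, so
`∫_{B ≤ K n} f → ∫ f` for every integrable `f`. [folklore] -/
theorem tendsto_setIntegral_good (hBm : StronglyMeasurable B) {K : ℕ → ℝ} (hKmono : Monotone K)
    (hKtop : Tendsto K atTop atTop) {f : Ω → ℝ} (hf : Integrable f μ) :
    Tendsto (fun n ↦ ∫ ω in {ω | B ω ≤ K n}, f ω ∂μ) atTop (𝓝 (∫ ω, f ω ∂μ)) := by
  have hmono : Monotone fun n ↦ {ω | B ω ≤ K n} := fun i j hij ω (hω : B ω ≤ K i) ↦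
    hω.trans (hKmono hij)
  have hunion : (⋃ n, {ω | B ω ≤ K n}) = univ := by
    refine eq_univ_of_forall fun ω ↦ ?_
    obtain ⟨n, hn⟩ := (hKtop.eventually_ge_atTop (B ω)).exists
    exact mem_iUnion.2 ⟨n, hn⟩
  have h := tendsto_setIntegral_of_monotone (μ := μ) (fun n ↦ measurableSet_good hBm (K n)) hmono
    (by rw [hunion]; exact hf.integrableOn)
  rwa [hunion, Measure.restrict_univ] at h

/-- The good events have probability tending to `1`. [folklore] -/
theorem tendsto_measureReal_good (hBm : StronglyMeasurable B) {K : ℕ → ℝ} (hKmono : Monotone K)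
    (hKtop : Tendsto K atTop atTop) :
    Tendsto (fun n ↦ μ.real {ω | B ω ≤ K n}) atTop (𝓝 1) := by
  have h := tendsto_setIntegral_good (μ := μ) hBm hKmono hKtop (integrable_const (1 : ℝ))
  simp only [integral_const, smul_eq_mul, mul_one, probReal_univ] at h
  simpa [Measure.real, Measure.restrict_apply MeasurableSet.univ, univ_inter] using h

omit [IsProbabilityMeasure μ] in
/-- **Registered form** (glue sub-goal `farField_setIntegral_good_tendsto` of stmt-CriticalPhenomena-0746):
integrals over the good events `{B ≤ K n}`, `K n ↑ ∞`, converge to the full integral. [folklore] -/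
theorem farField_setIntegral_good_tendsto : ∀ {Ω : Type*} {mΩ : MeasurableSpace Ω} {μ : MeasureTheory.Measure Ω} {B : Ω → ℝ}, MeasureTheory.StronglyMeasurable B → ∀ {K : ℕ → ℝ}, Monotone K → Filter.Tendsto K Filter.atTop Filter.atTop → ∀ {f : Ω → ℝ}, MeasureTheory.Integrable f μ → Filter.Tendsto (fun n ↦ ∫ ω in {ω | B ω ≤ K n}, f ω ∂μ) Filter.atTop (nhds (∫ ω, f ω ∂μ)) :=
  fun hBm _ hKmono hKtop _ hf ↦ tendsto_setIntegral_good hBm hKmono hKtop hf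

end Dominator

end FarField

end Summit.CriticalPhenomena.CardyFormulaZ2.Cruxes.CardyRigidity.CrossingMartingale

end
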